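import Literature.NumberTheory.LFunctions.MollifiedZetaMeanSquares
import Literature.Analysis.Complex.LittlewoodLemma
import Literature.Analysis.Complex.LittlewoodLemmaEdgeBounds
import Literature.Analysis.Complex.BacklundArgVariation
import Literature.Analysis.Complex.ArgumentPrincipleEdgeZeros
import HarnessLib

/-!
# Selberg's zero-density estimate near the critical line in short intervals

Topic `Literature/NumberTheory/LFunctions`. Everything in this file is PROVED (no definitions, no
named facts).

Selberg (1942/1946; Titchmarsh Theorem 9.19 (C) states the global form
`N(σ, T) = O(T^{1 − (σ−1/2)/4} log T)`): the number of zeros `ρ = β + iγ` of `ζ` with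
`β ≥ 1/2 + η`, `c < γ < d` in a window `[c, d] ⊂ [T₀ − V, T₀ + V]` is bounded through Littlewood's
lemma applied to `F = ζ ψ_X` on the rectangle `[α, 3] × [c', d']` (`α ≈ 1/2 + η/2`, generic
edges), the left edge being controlled by `∫ log|F| ≤ ∫ |F − 1|` and the Gaussian-weighted mean
square of `F − 1` interpolated by convexity
(`Literature.NumberTheory.LFunctions.TwistedMoment.meanSquare_zetaMollifierG_le_interp`,
`…_three_le`), the right edge by `|F − 1| ≤ 2X^{-1/2}`
(`Literature.NumberTheory.LFunctions.TwistedMoment.norm_zeta_mul_plateauMollifier_sub_one_le`), and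
the horizontal edges by Backlund's lemma
(`Literature.Analysis.Complex.abs_im_integral_logDeriv_le_backlund`).

* `Literature.NumberTheory.LFunctions.TwistedMoment.sum_zetaZeroOrder_le_of_meanSquare` — the count
  (with multiplicity, over any finite set `Z₀` of such zeros) in
  terms of a bound `B₁ ≥ ∫ |G_{X,T₀,V}(1/2+iy)|² dy`:
  `N ≤ (πη)⁻¹ {(30 (d−c+2)(B₁ (25/X)^{η/10} + 1))^{1/2} + 4(d−c+2) X^{-1/2} + A(d, X)}`,
  `A(d, X) = O(log d + log X)` explicit.

## References

* A. Selberg, *Contributions to the theory of the Riemann zeta-function*, Arch. Math. Naturvid. 48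
  (1946) no. 5, Theorem 1; *On the zeros of Riemann's zeta-function* (1942).
* E. C. Titchmarsh, *The Theory of the Riemann Zeta-Function*, 2nd ed. (1986), §9.16, Theorem
  9.19 (C), §9.24. [cite: Titchmarsh1986, §9.19]
-/

noncomputable section

open Complex Real MeasureTheory Set intervalIntegral
open Complex.HadamardThreeLines (verticalStrip verticalClosedStrip)
open Literature.Analysis.Complex

namespace Literature.NumberTheory.LFunctions.TwistedMoment

/-! ### `F = ζ ψ_X`: analyticity and the right edge -/

/-- `ζ ψ_X` is analytic off `s = 1`. [folklore] -/
theorem analyticAt_zeta_mul_psi (X : ℝ) {s : ℂ} (hs : s ≠ 1) :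
    AnalyticAt ℂ (fun z => riemannZeta z * plateauMollifier X z) s := by
  have hζ : AnalyticAt ℂ riemannZeta s := by
    refine Complex.analyticAt_iff_eventually_differentiableAt.2 ?_
    filter_upwards [isOpen_ne.mem_nhds hs] with z hz
    exact differentiableAt_riemannZeta hz
  exact hζ.mul ((differentiable_plateauMollifier X).analyticAt s)

/-- Points of a rectangle `[a,b] × [c,d]` with `c > 0` are `≠ 1`. [folklore] -/
theorem ne_one_of_mem_reProdIm {a b c d : ℝ} (hc : 0 < c) {s : ℂ} (hs : s ∈ Icc a b ×ℂ Icc c d) :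
    s ≠ 1 := by
  intro h
  have : s.im = 0 := by rw [h]; simp
  have h2 := hs.2.1
  rw [this] at h2
  linarith

/-- `ζ ψ_X` is analytic on closed rectangles in the upper half-plane. [folklore] -/
theorem analyticOnNhd_zeta_mul_psi (X : ℝ) {a b c d : ℝ} (hc : 0 < c) :
    AnalyticOnNhd ℂ (fun z => riemannZeta z * plateauMollifier X z) (Icc a b ×ℂ Icc c d) :=
  fun _ hs => analyticAt_zeta_mul_psi X (ne_one_of_mem_reProdIm hc hs)

/-- **The right edge**: for `X ≥ 16` and `Re s ≥ 3`, `‖ζψ_X(s) − 1‖ ≤ 1/2`, so `Re ζψ_X(s) > 0`,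
`‖ζψ_X(s)‖ ≥ 1/2` and `ζψ_X(s) ≠ 0`. [cite: Titchmarsh1986, §9.24] -/
theorem rightEdge_facts {X : ℝ} (hX : 16 ≤ X) {s : ℂ} (hs : 3 ≤ s.re) :
    ‖riemannZeta s * plateauMollifier X s - 1‖ ≤ 2 * X ^ (-(1 / 2 : ℝ)) ∧
    2 * X ^ (-(1 / 2 : ℝ)) ≤ 1 / 2 ∧
    0 < (riemannZeta s * plateauMollifier X s).re ∧
    1 / 2 ≤ ‖riemannZeta s * plateauMollifier X s‖ ∧
    riemannZeta s * plateauMollifier X s ≠ 0 := by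
  have h1 := norm_zeta_mul_plateauMollifier_sub_one_le (show (4 : ℝ) ≤ X by linarith) hs
  have h2 : 2 * X ^ (-(1 / 2 : ℝ)) ≤ 1 / 2 := by
    rw [Real.rpow_neg (by linarith), ← Real.sqrt_eq_rpow]
    have h4 : 4 ≤ Real.sqrt X := by rw [Real.le_sqrt (by norm_num) (by linarith)]; linarith
    have : (Real.sqrt X)⁻¹ ≤ 1 / 4 := by rw [inv_le_comm₀ (by linarith) (by norm_num)]; linarith
    linarith
  set w := riemannZeta s * plateauMollifier X s with hw
  have h3 : ‖w - 1‖ ≤ 1 / 2 := h1.trans h2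
  have hre : 1 / 2 ≤ w.re := by
    have := abs_re_le_norm (w - 1); rw [sub_re, one_re] at this
    have := (abs_le.1 (this.trans h3)).1; linarith
  have hnorm : 1 / 2 ≤ ‖w‖ := by
    have := norm_sub_norm_le 1 w
    rw [norm_one, norm_sub_rev] at this; linarith
  refine ⟨h1, h2, by linarith, hnorm, ?_⟩
  exact fun h0 => by rw [h0, norm_zero] at hnorm; linarith

/-- `−log‖ζψ_X(s)‖ ≤ 4 X^{-1/2}` on `Re s ≥ 3` (`X ≥ 16`). [folklore] -/
theorem neg_log_norm_rightEdge_le {X : ℝ} (hX : 16 ≤ X) {s : ℂ} (hs : 3 ≤ s.re) :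
    -Real.log ‖riemannZeta s * plateauMollifier X s‖ ≤ 4 * X ^ (-(1 / 2 : ℝ)) := by
  obtain ⟨h1, h2, -, hnorm, -⟩ := rightEdge_facts hX hs
  set u := 2 * X ^ (-(1 / 2 : ℝ)) with hu
  have hu0 : 0 ≤ u := by positivity
  have hwn : 1 - u ≤ ‖riemannZeta s * plateauMollifier X s‖ := by
    have := norm_sub_norm_le 1 (riemannZeta s * plateauMollifier X s)
    rw [norm_one, norm_sub_rev] at this; linarith
  have hpos : 0 < 1 - u := by linarith
  -- `−log‖w‖ ≤ −log(1−u) ≤ u/(1−u) ≤ 2u`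
  have hl1 : -Real.log ‖riemannZeta s * plateauMollifier X s‖ ≤ -Real.log (1 - u) := by
    have := Real.log_le_log hpos hwn; linarith
  have hl2 : -Real.log (1 - u) ≤ u / (1 - u) := by
    have := Real.one_sub_inv_le_log_of_pos hpos
    have e : 1 - (1 - u)⁻¹ = -(u / (1 - u)) := by field_simp; ring
    rw [e] at this; linarith
  have hl3 : u / (1 - u) ≤ 2 * u := by
    rw [div_le_iff₀ hpos]; nlinarith
  linarith

/-! ### Growth of `ζψ_X` in the discs of Backlund's lemma -/

/-- For `|z − (3 + iy₀)| ≤ 2.8`, `y₀ ≥ 3`, `X ≥ 1`: `‖ζψ_X(z)‖ ≤ 5 (y₀ + 12)⁴ X`. [folklore] -/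
theorem norm_zeta_mul_psi_disc_le {X y₀ : ℝ} (hX : 1 ≤ X) (hy₀ : 3 ≤ y₀) {z : ℂ}
    (hz : z ∈ Metric.closedBall ((3 : ℂ) + y₀ * I) 2.8) :
    ‖riemannZeta z * plateauMollifier X z‖ ≤ 5 * (y₀ + 12) ^ 4 * X := by
  rw [Metric.mem_closedBall, dist_eq_norm] at hz
  have hre : |z.re - 3| ≤ 2.8 := by
    have := abs_re_le_norm (z - (3 + y₀ * I)); simp at this; exact this.trans hz
  have him : |z.im - y₀| ≤ 2.8 := by
    have := abs_im_le_norm (z - (3 + y₀ * I)); simp at this; exact this.trans hz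
  have hre' := abs_le.1 hre
  have him' := abs_le.1 him
  have hz1 : z ≠ 1 := by
    intro h; rw [h] at him'; simp at him'; linarith
  have hzim : 0.2 ≤ |z.im| := by rw [abs_of_pos (by linarith)]; linarith
  -- `‖ζ z‖ = ‖ζ₁ z‖/‖z − 1‖ ≤ (‖z‖+2)^4 / 0.2`
  have hζ1 := Literature.NumberTheory.LFunctions.BurnolVectors.norm_riemannZeta₁_le (s := z) (by linarith)
  rw [Literature.NumberTheory.LFunctions.riemannZeta₁_eq_mul hz1, norm_mul] at hζ1
  have hz1n : 0.2 ≤ ‖z - 1‖ := by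
    have := abs_im_le_norm (z - 1); simp at this; exact hzim.trans this
  have hζ : ‖riemannZeta z‖ ≤ (‖z‖ + 2) ^ 4 / 0.2 := by
    rw [le_div_iff₀ (by norm_num)]
    calc ‖riemannZeta z‖ * 0.2 ≤ ‖riemannZeta z‖ * ‖z - 1‖ :=
          mul_le_mul_of_nonneg_left hz1n (norm_nonneg _)
      _ = ‖z - 1‖ * ‖riemannZeta z‖ := mul_comm _ _
      _ ≤ (‖z‖ + 2) ^ 4 := hζ1
  have hψ : ‖plateauMollifier X z‖ ≤ X := norm_plateauMollifier_le (by linarith) (by linarith)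
  have hzn : ‖z‖ + 2 ≤ y₀ + 12 := by
    have h1 : ‖z‖ ≤ |z.re| + |z.im| := Complex.norm_le_abs_re_add_abs_im z
    have h2 : |z.re| ≤ 5.8 := abs_le.2 ⟨by linarith, by linarith⟩
    have h3 : |z.im| ≤ y₀ + 2.8 := by rw [abs_of_pos (by linarith)]; linarith
    linarith
  have hpow : (‖z‖ + 2) ^ 4 ≤ (y₀ + 12) ^ 4 := pow_le_pow_left₀ (by positivity) hzn 4
  rw [norm_mul]
  calc ‖riemannZeta z‖ * ‖plateauMollifier X z‖ ≤ ((‖z‖ + 2) ^ 4 / 0.2) * X :=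
        mul_le_mul hζ hψ (norm_nonneg _) (by positivity)
    _ ≤ ((y₀ + 12) ^ 4 / 0.2) * X := by gcongr
    _ = 5 * (y₀ + 12) ^ 4 * X := by ring

/-- **Backlund's bound for the horizontal edges**: for `X ≥ 16`, `y₀ ≥ 3`, `1/2 ≤ x ≤ 3`, if `ζψ_X`
has no zero on `[x, 3] × {y₀}`, then
`|Im ∫_3^x (ζψ)'/(ζψ)(u + iy₀) du| ≤ π (15 (log 10 + 4 log(y₀+12) + log X) + 1)`.
[cite: Titchmarsh1986, §9.4] -/
theorem abs_im_integral_logDeriv_horizontal_le {X y₀ x : ℝ} (hX : 16 ≤ X) (hy₀ : 3 ≤ y₀)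
    (hx : 1 / 2 ≤ x) (hx3 : x ≤ 3)
    (h0 : ∀ u ∈ Icc x 3, riemannZeta (u + y₀ * I) * plateauMollifier X (u + y₀ * I) ≠ 0) :
    |(∫ u : ℝ in (3 : ℝ)..x, deriv (fun z => riemannZeta z * plateauMollifier X z) (u + y₀ * I) /
        (riemannZeta (u + y₀ * I) * plateauMollifier X (u + y₀ * I))).im| ≤
      π * (15 * (Real.log 10 + 4 * Real.log (y₀ + 12) + Real.log X) + 1) := by
  set F : ℂ → ℂ := fun z => riemannZeta z * plateauMollifier X z with hF
  have hX1 : 1 ≤ X := by linarith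
  set M := 5 * (y₀ + 12) ^ 4 * X with hM
  have hM1 : 1 ≤ M := by
    have : (1 : ℝ) ≤ (y₀ + 12) ^ 4 := one_le_pow₀ (by linarith)
    rw [hM]; nlinarith
  have hanal : ∀ z ∈ Metric.closedBall ((3 : ℂ) + y₀ * I) 2.8, AnalyticAt ℂ F z := by
    intro z hz
    refine analyticAt_zeta_mul_psi X ?_
    rw [Metric.mem_closedBall, dist_eq_norm] at hz
    intro h
    subst h
    have h1 := abs_im_le_norm ((1 : ℂ) - (3 + y₀ * I))
    have h2 := h1.trans hz
    simp at h2
    rw [abs_le] at h2; linarith [h2.1, h2.2]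
  have hgM : ∀ z ∈ Metric.closedBall ((3 : ℂ) + y₀ * I) 2.8, ‖F z‖ ≤ M := fun z hz =>
    norm_zeta_mul_psi_disc_le hX1 hy₀ hz
  obtain ⟨-, -, -, hnorm3, hne3⟩ := rightEdge_facts hX (s := (3 : ℂ) + y₀ * I) (by simp)
  have hc : F ((3 : ℝ) + y₀ * I) ≠ 0 := by simpa [hF] using hne3
  have key := abs_im_integral_logDeriv_le_backlund (g := F) (c := 3) (y := y₀) (r := 2.6) (R := 2.8)
    (M := M) (a := x) (b := 3) (by norm_num) (by norm_num) hM1 (by simpa using hanal) (by simpa using hgM)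
    hc hx3 (by linarith) (by norm_num) (fun u hu => h0 u hu)
  rw [intervalIntegral.integral_symm, Complex.neg_im, abs_neg]
  refine key.trans ?_
  refine mul_le_mul_of_nonneg_left ?_ Real.pi_pos.le
  -- `log(M/‖F(3+iy₀)‖) ≤ log(2M)` and `log(2.8/2.6) ≥ 1/15`
  have hF3 : 1 / 2 ≤ ‖F ((3 : ℝ) + y₀ * I)‖ := by simpa [hF] using hnorm3
  have hlog1 : Real.log (M / ‖F ((3 : ℝ) + y₀ * I)‖) ≤ Real.log (2 * M) := by
    refine Real.log_le_log (by positivity) ?_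
    rw [div_le_iff₀ (by linarith)]; nlinarith
  have hlog2 : 1 / 15 ≤ Real.log ((2.8 : ℝ) / 2.6) := by
    have h := Real.add_one_le_exp (1 / 15 : ℝ)
    rw [Real.le_log_iff_exp_le (by norm_num)]
    -- `e^{1/15} ≤ 2.8/2.6`: `e^{1/15} ≤ 1/(1 − 1/15) = 15/14 ≤ 2.8/2.6`
    have h2 : Real.exp (1 / 15 : ℝ) ≤ 15 / 14 := by
      have := Real.exp_bound' (x := (1 / 15 : ℝ)) (by norm_num) (by norm_num) (n := 2) (by norm_num)
      have h3 : Real.exp (1 / 15 : ℝ) ≤ 1 / (1 - 1 / 15) := by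
        have hh := Real.one_sub_le_exp_neg (1 / 15 : ℝ) -- `1 − x ≤ e^{−x}` hmm we need the inverse
        rw [Real.exp_neg] at hh
        rw [le_div_iff₀ (by norm_num)]
        have hpos : 0 < Real.exp (1 / 15 : ℝ) := Real.exp_pos _
        have := mul_le_mul_of_nonneg_left hh hpos.le
        rw [mul_inv_cancel₀ hpos.ne'] at this
        linarith
      linarith
    linarith
  have hlogM : Real.log (2 * M) = Real.log 10 + 4 * Real.log (y₀ + 12) + Real.log X := by
    rw [hM, show 2 * (5 * (y₀ + 12) ^ 4 * X) = 10 * ((y₀ + 12) ^ 4 * X) by ring,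
      Real.log_mul (by norm_num) (by positivity), Real.log_mul (by positivity) (by positivity),
      Real.log_pow]; push_cast; ring
  have hlogM0 : 0 ≤ Real.log (2 * M) := Real.log_nonneg (by linarith)
  calc Real.log (M / ‖F ((3 : ℝ) + y₀ * I)‖) / Real.log (2.8 / 2.6) + 1
      ≤ Real.log (2 * M) / (1 / 15) + 1 := by
        gcongr
    _ = 15 * (Real.log 10 + 4 * Real.log (y₀ + 12) + Real.log X) + 1 := by rw [hlogM]; ring

/-! ### Generic edges, and counting the zeros of `ζ` by the zeros of `ζψ_X` -/

/-- A finite set of complex numbers misses some horizontal line through any interval of heights.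
[folklore] -/
theorem exists_im_ne_of_finite {Z : Set ℂ} (hZ : Z.Finite) {p q : ℝ} (hpq : p < q) :
    ∃ t ∈ Icc p q, ∀ ρ ∈ Z, ρ.im ≠ t := by
  obtain ⟨t, ht, hnot⟩ := (Set.Icc_infinite hpq).exists_notMem_finset (hZ.image Complex.im).toFinset
  refine ⟨t, ht, fun ρ hρ h => hnot ?_⟩
  rw [Set.Finite.mem_toFinset]; exact ⟨ρ, hρ, h⟩

/-- … and some vertical line through any interval of abscissae. [folklore] -/
theorem exists_re_ne_of_finite {Z : Set ℂ} (hZ : Z.Finite) {p q : ℝ} (hpq : p < q) :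
    ∃ t ∈ Icc p q, ∀ ρ ∈ Z, ρ.re ≠ t := by
  obtain ⟨t, ht, hnot⟩ := (Set.Icc_infinite hpq).exists_notMem_finset (hZ.image Complex.re).toFinset
  refine ⟨t, ht, fun ρ hρ h => hnot ?_⟩
  rw [Set.Finite.mem_toFinset]; exact ⟨ρ, hρ, h⟩

/-- For `f` analytic at `z` with `f z = 0` and finite order, the multiplicity is `≥ 1`. [folklore] -/
theorem one_le_untop₀_meromorphicOrderAt {f : ℂ → ℂ} {z : ℂ} (hf : AnalyticAt ℂ f z) (hz : f z = 0)
    (htop : analyticOrderAt f z ≠ ⊤) : (1 : ℝ) ≤ ((meromorphicOrderAt f z).untop₀ : ℝ) := by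
  rw [hf.meromorphicOrderAt_eq]
  cases h : analyticOrderAt f z with
  | top => exact absurd h htop
  | coe n =>
    have hn : n ≠ 0 := by
      intro hn0
      rw [hn0] at h
      exact (hf.analyticOrderAt_eq_zero.1 (by exact_mod_cast h)) hz
    have : 1 ≤ n := Nat.one_le_iff_ne_zero.2 hn
    simp
    exact_mod_cast this

/-- **The zeros of `ζ` are zeros of `ζψ_X` of multiplicity `≥ 1`**: for `ζψ_X` analytic on the
closed rectangle `[a, b] × [c', d']` (`c' > 0`), non-zero somewhere on it, `a < σ`, `b = 3`,
`(c, d) ⊆ (c', d')`,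
`#{ρ : ζ(ρ) = 0, Re ρ ≥ σ, c < Im ρ < d} ≤ Σᶠ_{ζψ(ρ) = 0, ρ ∈ [σ, 3) × (c', d')} m(ρ)`. [folklore] -/
theorem ncard_zetaZeros_le_finsum {X a c' d' c d σ : ℝ} (ha : a ≤ 3) (hc' : 0 < c') (hc'd' : c' ≤ d')
    (hcc' : c' ≤ c) (hdd' : d ≤ d') (haσ : a ≤ σ)
    {w : ℂ} (hw : w ∈ Icc a 3 ×ℂ Icc c' d') (hfw : riemannZeta w * plateauMollifier X w ≠ 0) :
    ((Set.ncard {ρ : ℂ | riemannZeta ρ = 0 ∧ σ ≤ ρ.re ∧ c < ρ.im ∧ ρ.im < d} : ℕ) : ℝ) ≤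
      ∑ᶠ ρ ∈ {ρ : ℂ | riemannZeta ρ * plateauMollifier X ρ = 0 ∧ ρ ∈ Ico σ 3 ×ℂ Ioo c' d'},
        ((meromorphicOrderAt (fun z => riemannZeta z * plateauMollifier X z) ρ).untop₀ : ℝ) := by
  set F : ℂ → ℂ := fun z => riemannZeta z * plateauMollifier X z with hF
  have hFanal : AnalyticOnNhd ℂ F (Icc a 3 ×ℂ Icc c' d') := analyticOnNhd_zeta_mul_psi X hc'
  set SF := {ρ : ℂ | riemannZeta ρ * plateauMollifier X ρ = 0 ∧ ρ ∈ Ico σ 3 ×ℂ Ioo c' d'} with hSF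
  set Sζ := {ρ : ℂ | riemannZeta ρ = 0 ∧ σ ≤ ρ.re ∧ c < ρ.im ∧ ρ.im < d} with hSζ
  have hfinAll := finite_zeros_closed_reProdIm ha hc'd' hFanal hw hfw
  have hSFsub : SF ⊆ {ρ : ℂ | F ρ = 0 ∧ ρ ∈ Icc a 3 ×ℂ Icc c' d'} := fun ρ hρ =>
    ⟨hρ.1, ⟨haσ.trans hρ.2.1.1, hρ.2.1.2.le⟩, ⟨hρ.2.2.1.le, hρ.2.2.2.le⟩⟩
  have hfinSF : SF.Finite := hfinAll.subset hSFsub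
  have hsub : Sζ ⊆ SF := by
    intro ρ hρ
    obtain ⟨h0, h1, h2, h3⟩ := hρ
    have hre3 : ρ.re < 3 := by
      by_contra h
      push Not at h
      exact riemannZeta_ne_zero_of_one_le_re (by linarith) h0
    exact ⟨by simp [h0], ⟨h1, hre3⟩, ⟨by linarith, by linarith⟩⟩
  have hfinSζ : Sζ.Finite := hfinSF.subset hsub
  -- `ncard Sζ ≤ ncard SF = Σ_{SF} 1 ≤ Σ_{SF} m(ρ)`
  have h1 : (Sζ.ncard : ℝ) ≤ (SF.ncard : ℝ) := by exact_mod_cast Set.ncard_le_ncard hsub hfinSF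
  refine h1.trans ?_
  rw [finsum_mem_eq_finite_toFinset_sum _ hfinSF, Set.ncard_eq_toFinset_card _ hfinSF]
  rw [show ((hfinSF.toFinset.card : ℕ) : ℝ) = ∑ ρ ∈ hfinSF.toFinset, (1 : ℝ) by simp]
  refine Finset.sum_le_sum fun ρ hρ => ?_
  rw [Set.Finite.mem_toFinset] at hρ
  have hρK : ρ ∈ Icc a 3 ×ℂ Icc c' d' := (hSFsub hρ).2
  exact one_le_untop₀_meromorphicOrderAt (hFanal ρ hρK) hρ.1
    (analyticOrderAt_ne_top_of_reProdIm ha hc'd' hFanal hw hfw hρK)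

/-- The multiplicity of `ζ` at `z` is at most that of `ζψ_X` (both analytic at `z`, `ψ_X ≢ 0` near
`z`). [folklore] -/
theorem zetaZeroOrder_le_untop₀_mul {X : ℝ} {z : ℂ} (hz : z ≠ 1)
    (hψ : analyticOrderAt (plateauMollifier X) z ≠ ⊤) :
    (riemannZetaZeroOrder z : ℝ) ≤ (meromorphicOrderAt (fun w => riemannZeta w * plateauMollifier X w) z).untop₀ := by
  have hζ : AnalyticAt ℂ riemannZeta z := by
    refine Complex.analyticAt_iff_eventually_differentiableAt.2 ?_
    filter_upwards [isOpen_ne.mem_nhds hz] with w hw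
    exact differentiableAt_riemannZeta hw
  have hψa : AnalyticAt ℂ (plateauMollifier X) z := (differentiable_plateauMollifier X).analyticAt z
  have hmul : (fun w => riemannZeta w * plateauMollifier X w) = riemannZeta * plateauMollifier X := rfl
  rw [riemannZetaZeroOrder, hmul, hζ.meromorphicOrderAt_eq, (hζ.mul hψa).meromorphicOrderAt_eq,
    analyticOrderAt_mul hζ hψa]
  cases h1 : analyticOrderAt riemannZeta z with
  | top => simp
  | coe n =>
    cases h2 : analyticOrderAt (plateauMollifier X) z with
    | top => exact absurd h2 hψ
    | coe k =>
      rw [show ((n : ℕ∞) + (k : ℕ∞)) = ((n + k : ℕ) : ℕ∞) by push_cast; rfl, ENat.map_coe, ENat.map_coe,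
        WithTop.untop₀_coe, WithTop.untop₀_coe]
      push_cast
      linarith [(Nat.cast_nonneg k : (0 : ℝ) ≤ k)]

/-- **The zeros of `ζ`, with multiplicity, are dominated by the zeros of `ζψ_X`**: for a finite set
`Z₀` of zeros of `ζ` with `Re ρ ≥ σ`, `c < Im ρ < d` (`a ≤ σ`, `(c, d) ⊆ (c', d')`, `c' > 0`, and `ζψ_X`
non-zero somewhere on `[a, 3] × [c', d']`),
`∑_{ρ∈Z₀} m(ρ) ≤ Σᶠ_{ζψ(ρ) = 0, ρ ∈ [σ, 3) × (c', d')} m_{ζψ}(ρ)`. [folklore] -/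
theorem sum_zetaZeroOrder_le_finsum {X a c' d' c d σ : ℝ} (ha : a ≤ 3) (hc' : 0 < c') (hc'd' : c' ≤ d')
    (hcc' : c' ≤ c) (hdd' : d ≤ d') (haσ : a ≤ σ)
    {w : ℂ} (hw : w ∈ Icc a 3 ×ℂ Icc c' d') (hfw : riemannZeta w * plateauMollifier X w ≠ 0)
    (Z₀ : Finset ℂ) (hZ₀ : ∀ ρ ∈ Z₀, riemannZeta ρ = 0 ∧ σ ≤ ρ.re ∧ c < ρ.im ∧ ρ.im < d) :
    ∑ ρ ∈ Z₀, (riemannZetaZeroOrder ρ : ℝ) ≤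
      ∑ᶠ ρ ∈ {ρ : ℂ | riemannZeta ρ * plateauMollifier X ρ = 0 ∧ ρ ∈ Ico σ 3 ×ℂ Ioo c' d'},
        ((meromorphicOrderAt (fun z => riemannZeta z * plateauMollifier X z) ρ).untop₀ : ℝ) := by
  set F : ℂ → ℂ := fun z => riemannZeta z * plateauMollifier X z with hF
  have hFanal : AnalyticOnNhd ℂ F (Icc a 3 ×ℂ Icc c' d') := analyticOnNhd_zeta_mul_psi X hc'
  set SF := {ρ : ℂ | riemannZeta ρ * plateauMollifier X ρ = 0 ∧ ρ ∈ Ico σ 3 ×ℂ Ioo c' d'} with hSF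
  have hfinAll := finite_zeros_closed_reProdIm ha hc'd' hFanal hw hfw
  have hSFsub : SF ⊆ {ρ : ℂ | F ρ = 0 ∧ ρ ∈ Icc a 3 ×ℂ Icc c' d'} := fun ρ hρ =>
    ⟨hρ.1, ⟨haσ.trans hρ.2.1.1, hρ.2.1.2.le⟩, ⟨hρ.2.2.1.le, hρ.2.2.2.le⟩⟩
  have hfinSF : SF.Finite := hfinAll.subset hSFsub
  have hsub : ↑Z₀ ⊆ SF := by
    intro ρ hρ
    obtain ⟨h0, h1, h2, h3⟩ := hZ₀ ρ hρ
    have hre3 : ρ.re < 3 := by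
      by_contra h
      push Not at h
      exact riemannZeta_ne_zero_of_one_le_re (by linarith) h0
    exact ⟨by simp [h0], ⟨h1, hre3⟩, ⟨by linarith, by linarith⟩⟩
  rw [finsum_mem_eq_finite_toFinset_sum _ hfinSF]
  have hsub' : Z₀ ⊆ hfinSF.toFinset := fun ρ hρ => by rw [Set.Finite.mem_toFinset]; exact hsub hρ
  calc ∑ ρ ∈ Z₀, (riemannZetaZeroOrder ρ : ℝ)
      ≤ ∑ ρ ∈ Z₀, ((meromorphicOrderAt F ρ).untop₀ : ℝ) := by
        refine Finset.sum_le_sum fun ρ hρ => ?_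
        have hρK : ρ ∈ Icc a 3 ×ℂ Icc c' d' := (hSFsub (hsub hρ)).2
        have hne1 : ρ ≠ 1 := ne_one_of_mem_reProdIm hc' hρK
        -- `ψ_X ≢ 0` near `ρ`: otherwise `F ≡ 0` near `ρ`, contradicting `F w ≠ 0`
        have hψ : analyticOrderAt (plateauMollifier X) ρ ≠ ⊤ := by
          intro htop
          have hFtop : analyticOrderAt F ρ = ⊤ := by
            have hζa : AnalyticAt ℂ riemannZeta ρ := by
              refine Complex.analyticAt_iff_eventually_differentiableAt.2 ?_
              filter_upwards [isOpen_ne.mem_nhds hne1] with z hz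
              exact differentiableAt_riemannZeta hz
            have hmul : F = riemannZeta * plateauMollifier X := rfl
            rw [hmul, analyticOrderAt_mul hζa ((differentiable_plateauMollifier X).analyticAt ρ), htop]
            simp
          exact analyticOrderAt_ne_top_of_reProdIm ha hc'd' hFanal hw hfw hρK hFtop
        exact zetaZeroOrder_le_untop₀_mul hne1 hψ
    _ ≤ ∑ ρ ∈ hfinSF.toFinset, ((meromorphicOrderAt F ρ).untop₀ : ℝ) := by
        refine Finset.sum_le_sum_of_subset_of_nonneg hsub' fun ρ hρ _ => ?_
        rw [Set.Finite.mem_toFinset] at hρ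
        have hρK : ρ ∈ Icc a 3 ×ℂ Icc c' d' := (hSFsub hρ).2
        have := one_le_untop₀_meromorphicOrderAt (hFanal ρ hρK) hρ.1
          (analyticOrderAt_ne_top_of_reProdIm ha hc'd' hFanal hw hfw hρK)
        linarith

/-! ### The left edge: `∫ log|ζψ| ≤ ∫ |ζψ − 1|` and the convexity bound -/

/-- `log‖w‖ ≤ ‖w − 1‖`. [folklore] -/
theorem log_norm_le_norm_sub_one (w : ℂ) : Real.log ‖w‖ ≤ ‖w - 1‖ := by
  rcases eq_or_ne w 0 with rfl | hw
  · simp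
  have h1 : Real.log ‖w‖ ≤ ‖w‖ - 1 := Real.log_le_sub_one_of_pos (norm_pos_iff.2 hw)
  have h2 : ‖w‖ ≤ ‖w - 1‖ + 1 := by
    have := norm_add_le (w - 1) 1; rwa [sub_add_cancel, norm_one] at this
  linarith

/-- On the window `[c, d] ⊆ [T₀ − V, T₀ + V]` with `c ≥ 3`, for `1/2 ≤ α ≤ 3`:
`‖ζψ_X(α+iy) − 1‖² ≤ 21 ‖G_{X,T₀,V}(α+iy)‖²`. [folklore] -/
theorem norm_sub_one_sq_le_norm_G_sq {X T₀ V α c d : ℝ} (hV : 3 ≤ V) (hα : 1 / 2 ≤ α) (hc : 3 ≤ c)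
    (hcT : T₀ - V ≤ c) (hdT : d ≤ T₀ + V) {y : ℝ} (hy : y ∈ Icc c d) :
    ‖riemannZeta (α + y * I) * plateauMollifier X (α + y * I) - 1‖ ^ 2 ≤
      21 * ‖zetaMollifierG X T₀ V (α + y * I)‖ ^ 2 := by
  have hV0 : 0 < V := by linarith
  set s : ℂ := α + y * I with hs
  have hsre : s.re = α := by simp [hs]
  have hsim : s.im = y := by simp [hs]
  have hs1 : s ≠ 1 := by
    intro h; have := congrArg Complex.im h; rw [hsim] at this; simp at this; linarith [hy.1]
  have hsm1 : 3 ≤ ‖s - 1‖ := by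
    have := abs_im_le_norm (s - 1); simp [hs] at this
    rw [abs_of_pos (by linarith [hy.1])] at this; linarith [hy.1]
  have hsp1 : s + 1 ≠ 0 := by
    intro h; have := congrArg Complex.re h; simp [hs] at this; linarith
  -- `h = G · (s+1)/(s−1) · E⁻¹`
  have hG := zetaMollifierG_eq (X := X) (T₀ := T₀) (V := V) hs1
  set hval := riemannZeta s * plateauMollifier X s - 1 with hh
  set E := cexp (((s - 1 / 2 - T₀ * I) / V) ^ 2) with hE
  have hE0 : E ≠ 0 := Complex.exp_ne_zero _
  have hsub1 : s - 1 ≠ 0 := sub_ne_zero.2 hs1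
  have heq : hval = zetaMollifierG X T₀ V s * ((s + 1) / (s - 1)) * E⁻¹ := by
    rw [hG]; field_simp
  -- the factors
  have hf1 : ‖(s + 1) / (s - 1)‖ ≤ 5 / 3 := by
    rw [norm_div, div_le_iff₀ (by linarith)]
    have : ‖s + 1‖ ≤ ‖s - 1‖ + 2 := by
      have := norm_add_le (s - 1) 2; rw [show s - 1 + 2 = s + 1 by ring] at this
      simpa using this
    nlinarith
  have hf2 : ‖E⁻¹‖ ≤ Real.exp 1 := by
    rw [norm_inv, hE, norm_cexp_gaussFactor T₀ hV0 s, hsre, hsim, ← Real.exp_neg]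
    refine Real.exp_le_exp.2 ?_
    have hV2 : 0 < V ^ 2 := by positivity
    rw [← neg_div, div_le_iff₀ hV2, one_mul]
    have hyT : (y - T₀) ^ 2 ≤ V ^ 2 := by
      have : |y - T₀| ≤ V := abs_le.2 ⟨by linarith [hy.1], by linarith [hy.2]⟩
      calc (y - T₀) ^ 2 = |y - T₀| ^ 2 := (sq_abs _).symm
        _ ≤ V ^ 2 := pow_le_pow_left₀ (abs_nonneg _) this 2
    nlinarith [sq_nonneg (α - 1 / 2)]
  have hnorm : ‖hval‖ ≤ ‖zetaMollifierG X T₀ V s‖ * (5 / 3) * Real.exp 1 := by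
    rw [heq, norm_mul, norm_mul]
    gcongr
  have he3 : Real.exp 1 ≤ 2.72 := by have := Real.exp_one_lt_d9; linarith
  have h0 : 0 ≤ ‖zetaMollifierG X T₀ V s‖ := norm_nonneg _
  calc ‖hval‖ ^ 2 ≤ (‖zetaMollifierG X T₀ V s‖ * (5 / 3) * Real.exp 1) ^ 2 :=
        pow_le_pow_left₀ (norm_nonneg _) hnorm 2
    _ = ‖zetaMollifierG X T₀ V s‖ ^ 2 * ((5 / 3) * Real.exp 1) ^ 2 := by ring
    _ ≤ ‖zetaMollifierG X T₀ V s‖ ^ 2 * 21 := by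
        refine mul_le_mul_of_nonneg_left ?_ (by positivity)
        nlinarith [Real.exp_pos (1 : ℝ)]
    _ = _ := by ring

/-- **The left-edge integral**: for `1/2 ≤ α ≤ 3`, `3 ≤ c ≤ d` inside the window, `ζψ_X ≠ 0` on
the edge, and any `λ > 0`,
`∫_c^d log‖ζψ_X(α+iy)‖ dy ≤ (d − c) λ/2 + (11/λ) ∫ |G(α+iy)|² dy`. [cite: Titchmarsh1986, §9.16] -/
theorem integral_log_norm_leftEdge_le {X T₀ V α c d lam : ℝ} (hX : 1 ≤ X) (hV : 3 ≤ V)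
    (hα : 1 / 2 ≤ α) (hα3 : α ≤ 3) (hc : 3 ≤ c) (hcd : c ≤ d) (hcT : T₀ - V ≤ c) (hdT : d ≤ T₀ + V)
    (hlam : 0 < lam)
    (h0 : ∀ y ∈ Icc c d, riemannZeta (α + y * I) * plateauMollifier X (α + y * I) ≠ 0) :
    ∫ y in c..d, Real.log ‖riemannZeta (α + y * I) * plateauMollifier X (α + y * I)‖ ≤
      (d - c) * lam / 2 + (11 / lam) * ∫ y : ℝ, ‖zetaMollifierG X T₀ V (α + y * I)‖ ^ 2 := by
  have hV0 : 0 < V := by linarith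
  set F : ℂ → ℂ := fun z => riemannZeta z * plateauMollifier X z with hF
  -- integrability of `‖G(α+iy)‖²` on `ℝ`
  have hGdiff : DifferentiableOn ℂ (zetaMollifierG X T₀ V) (verticalStrip (1 / 2 - 1 / 4) (3 + 1 / 4)) := by
    refine (differentiableOn_zetaMollifierG X T₀ V).mono fun s hs => ?_
    rw [mem_verticalStrip_iff] at hs
    simp only [Set.mem_setOf_eq]; linarith [hs.1]
  have hGB : ∀ z ∈ verticalClosedStrip (1 / 2 - 1 / 4) (3 + 1 / 4), ‖zetaMollifierG X T₀ V z‖ ≤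
      (450 * X * (6 + |T₀|) ^ 4 * (1 + V) ^ 4) * Real.exp (-(z.im - T₀) ^ 2 / (Real.sqrt 2 * V) ^ 2) := by
    intro z hz
    have hz' : z ∈ verticalClosedStrip (1 / 4 : ℝ) (13 / 4) := by
      rw [mem_verticalClosedStrip_iff] at hz ⊢; constructor <;> linarith [hz.1, hz.2]
    exact norm_zetaMollifierG_le hX hV hz'
  have hIG : Integrable fun y : ℝ => ‖zetaMollifierG X T₀ V (α + y * I)‖ ^ 2 :=
    Literature.Analysis.Complex.integrable_norm_sq_vertical (by positivity) hGdiff hGB ⟨by linarith, by linarith⟩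
  -- continuity of the integrands on `[c, d]`
  have hFcont : ContinuousOn (fun y : ℝ => F (α + y * I)) (Icc c d) := by
    intro y hy
    have hne : (α : ℂ) + y * I ≠ 1 := by
      intro h; have := congrArg Complex.im h; simp at this; linarith [hy.1]
    exact ((analyticAt_zeta_mul_psi X hne).continuousAt.comp_of_eq
      (f := fun y : ℝ => (α : ℂ) + y * I) (by fun_prop) rfl).continuousWithinAt
  have hlogcont : ContinuousOn (fun y : ℝ => Real.log ‖F (α + y * I)‖) (Icc c d) :=
    hFcont.norm.log fun y hy => norm_ne_zero_iff.2 (h0 y hy)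
  have hGcont : Continuous fun y : ℝ => ‖zetaMollifierG X T₀ V (α + y * I)‖ ^ 2 := by
    refine ((differentiableOn_zetaMollifierG X T₀ V).continuousOn.comp_continuous
      (continuous_const.add (Complex.continuous_ofReal.mul continuous_const)) fun y => ?_).norm.pow 2
    simp only [Set.mem_setOf_eq]; simp; linarith
  -- pointwise: `log‖F‖ ≤ ‖F − 1‖ ≤ λ/2 + ‖F−1‖²/(2λ) ≤ λ/2 + (11/λ)‖G‖²`
  have hpt : ∀ y ∈ Icc c d, Real.log ‖F (α + y * I)‖ ≤
      lam / 2 + (11 / lam) * ‖zetaMollifierG X T₀ V (α + y * I)‖ ^ 2 := by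
    intro y hy
    have h1 := log_norm_le_norm_sub_one (F (α + y * I))
    set n := ‖F (α + y * I) - 1‖ with hn
    have hn0 : 0 ≤ n := norm_nonneg _
    have h2 : n ≤ lam / 2 + n ^ 2 / (2 * lam) := by
      have : 2 * lam * n ≤ n ^ 2 + lam ^ 2 := by nlinarith [sq_nonneg (n - lam)]
      rw [div_add_div _ _ (by norm_num) (by positivity), le_div_iff₀ (by positivity)]
      nlinarith
    have h3 : n ^ 2 ≤ 21 * ‖zetaMollifierG X T₀ V (α + y * I)‖ ^ 2 :=
      norm_sub_one_sq_le_norm_G_sq (X := X) hV hα hc hcT hdT hy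
    have h4 : n ^ 2 / (2 * lam) ≤ (11 / lam) * ‖zetaMollifierG X T₀ V (α + y * I)‖ ^ 2 := by
      rw [div_le_iff₀ (by positivity)]
      have : 0 ≤ ‖zetaMollifierG X T₀ V (α + y * I)‖ ^ 2 := by positivity
      calc n ^ 2 ≤ 21 * ‖zetaMollifierG X T₀ V (α + y * I)‖ ^ 2 := h3
        _ ≤ 11 / lam * ‖zetaMollifierG X T₀ V (↑α + ↑y * I)‖ ^ 2 * (2 * lam) := by
            rw [show 11 / lam * ‖zetaMollifierG X T₀ V (↑α + ↑y * I)‖ ^ 2 * (2 * lam) =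
              22 * ‖zetaMollifierG X T₀ V (↑α + ↑y * I)‖ ^ 2 by field_simp; ring]
            nlinarith
    linarith
  -- integrate over `[c, d]`
  have hmono : ∫ y in c..d, Real.log ‖F (α + y * I)‖ ≤
      ∫ y in c..d, (lam / 2 + (11 / lam) * ‖zetaMollifierG X T₀ V (α + y * I)‖ ^ 2) :=
    intervalIntegral.integral_mono_on hcd (hlogcont.intervalIntegrable_of_Icc hcd)
      ((continuous_const.add (continuous_const.mul hGcont)).intervalIntegrable _ _) hpt
  refine hmono.trans ?_
  have hii : IntervalIntegrable (fun y : ℝ => 11 / lam * ‖zetaMollifierG X T₀ V (α + y * I)‖ ^ 2)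
      MeasureTheory.volume c d := (continuous_const.mul hGcont).intervalIntegrable _ _
  have hci : IntervalIntegrable (fun _ : ℝ => lam / 2) MeasureTheory.volume c d := intervalIntegrable_const
  rw [intervalIntegral.integral_add hci hii, intervalIntegral.integral_const,
    intervalIntegral.integral_const_mul, smul_eq_mul]
  have hle : ∫ y in c..d, ‖zetaMollifierG X T₀ V (α + y * I)‖ ^ 2 ≤
      ∫ y : ℝ, ‖zetaMollifierG X T₀ V (α + y * I)‖ ^ 2 := by
    rw [intervalIntegral.integral_of_le hcd]
    exact setIntegral_le_integral hIG (ae_of_all _ fun y => by positivity)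
  have : 11 / lam * ∫ y in c..d, ‖zetaMollifierG X T₀ V (α + y * I)‖ ^ 2 ≤
      11 / lam * ∫ y : ℝ, ‖zetaMollifierG X T₀ V (α + y * I)‖ ^ 2 :=
    mul_le_mul_of_nonneg_left hle (by positivity)
  nlinarith

/-! ### The density estimate -/

/-- `−∫_{c}^{d} log‖ζψ_X(3+iy)‖ dy ≤ 4 (d − c) X^{-1/2}` (`X ≥ 16`, `c ≤ d`). [folklore] -/
theorem neg_integral_log_norm_rightEdge_le {X c d : ℝ} (hX : 16 ≤ X) (hcd : c ≤ d) :
    -(∫ y in c..d, Real.log ‖riemannZeta (3 + y * I) * plateauMollifier X (3 + y * I)‖) ≤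
      4 * (d - c) * X ^ (-(1 / 2 : ℝ)) := by
  have hcont : ContinuousOn (fun y : ℝ => Real.log ‖riemannZeta (3 + y * I) * plateauMollifier X (3 + y * I)‖)
      (Icc c d) := by
    intro y hy
    have hne : (3 : ℂ) + y * I ≠ 1 := by
      intro h; have := congrArg Complex.re h; simp at this
    have h0 := (rightEdge_facts hX (s := (3 : ℂ) + y * I) (by simp)).2.2.2.2
    refine ((ContinuousAt.comp_of_eq (analyticAt_zeta_mul_psi X hne).continuousAt
      (f := fun y : ℝ => (3 : ℂ) + y * I) (by fun_prop) rfl).norm.log (norm_ne_zero_iff.2 h0)).continuousWithinAt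
  rw [← intervalIntegral.integral_neg]
  have hci : IntervalIntegrable (fun _ : ℝ => 4 * X ^ (-(1 / 2 : ℝ))) MeasureTheory.volume c d :=
    intervalIntegrable_const
  have hmono := intervalIntegral.integral_mono_on hcd (hcont.intervalIntegrable_of_Icc hcd).neg hci
    (fun y _ => neg_log_norm_rightEdge_le hX (s := (3 : ℂ) + y * I) (by simp))
  refine hmono.trans ?_
  rw [intervalIntegral.integral_const, smul_eq_mul]; ring_nf; rfl

set_option maxHeartbeats 1600000 in
/-- **Selberg's zero-density estimate near the critical line, in a short window** (Selberg 1946,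
Theorem 1; Titchmarsh Theorem 9.19 (C) for the long-interval form): let `X ≥ 25`, `V ≥ 3`,
`4 ≤ c ≤ d` with `[c−1, d+1] ⊆ [T₀ − V, T₀ + V]`, `0 < η ≤ 1`, and let `B₁ ≥ V` bound the
Gaussian-weighted critical-line mean square `∫ |G_{X,T₀,V}(1/2+iy)|² dy`. Then
`∑_{ρ ∈ Z₀} m(ρ) ≤ (πη)⁻¹ {(22 B₁ (25/X)^{η/10} (d−c+2))^{1/2} + 4(d−c+2)X^{-1/2} + 5π(15(log 10 + 4 log(d+13) + log X) + 1) + 5π/2}`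
— Littlewood's lemma for `ζψ_X` on `[α', 3] × [c', d']` with generic edges, the left edge by
`log|F| ≤ |F − 1|` and the convexity bound `J(α') ≤ J(1/2)^{1−θ} J(3)^θ ≤ B₁ (25/X)^{η/10}`, the
right edge by `|F − 1| ≤ 2X^{-1/2}`, the horizontal edges by Backlund's lemma.
[cite: Titchmarsh1986, §9.19] -/
theorem sum_zetaZeroOrder_le_of_meanSquare {X T₀ V B₁ η c d : ℝ} (hX : 25 ≤ X) (hV : 3 ≤ V)
    (hc : 4 ≤ c) (hcd : c ≤ d) (hcV : T₀ - V ≤ c - 1) (hdV : d + 1 ≤ T₀ + V) (hη : 0 < η) (hη1 : η ≤ 1)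
    (hJ : ∫ y : ℝ, ‖zetaMollifierG X T₀ V ((1 / 2 : ℝ) + y * I)‖ ^ 2 ≤ B₁) (hB₁ : V ≤ B₁)
    (Z₀ : Finset ℂ) (hZ₀ : ∀ ρ ∈ Z₀, riemannZeta ρ = 0 ∧ 1 / 2 + η ≤ ρ.re ∧ c < ρ.im ∧ ρ.im < d) :
    ∑ ρ ∈ Z₀, (riemannZetaZeroOrder ρ : ℝ) ≤
      (1 / (π * η)) * (Real.sqrt (22 * (B₁ * (25 / X) ^ (η / 10)) * (d - c + 2))
        + 4 * (d - c + 2) * X ^ (-(1 / 2 : ℝ))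
        + 5 * (π * (15 * (Real.log 10 + 4 * Real.log (d + 13) + Real.log X) + 1)) + 5 / 2 * π) := by
  have hX16 : (16 : ℝ) ≤ X := by linarith
  have hX1 : (1 : ℝ) ≤ X := by linarith
  have hX0 : (0 : ℝ) < X := by linarith
  have hV0 : 0 < V := by linarith
  have hB₁0 : 0 < B₁ := by linarith
  set F : ℂ → ℂ := fun z => riemannZeta z * plateauMollifier X z with hF
  -- the finite set of zeros of `F` in the big closed rectangle
  have hbig : AnalyticOnNhd ℂ F (Icc (1 / 4 : ℝ) 4 ×ℂ Icc (c - 1) (d + 1)) :=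
    analyticOnNhd_zeta_mul_psi X (by linarith)
  have hw : ((3 : ℂ) + c * I) ∈ (Icc (1 / 4 : ℝ) 4 ×ℂ Icc (c - 1) (d + 1)) := by
    refine ⟨⟨?_, ?_⟩, ⟨?_, ?_⟩⟩ <;> norm_num; linarith
  have hFw : F ((3 : ℂ) + c * I) ≠ 0 := (rightEdge_facts hX16 (s := (3 : ℂ) + c * I) (by simp)).2.2.2.2
  have hZ := finite_zeros_closed_reProdIm (by norm_num : (1 / 4 : ℝ) ≤ 4) (by linarith : c - 1 ≤ d + 1) hbig hw hFw
  -- generic edges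
  obtain ⟨c', hc'I, hc'Z⟩ := exists_im_ne_of_finite hZ (by linarith : c - 1 < c - 1 / 2)
  obtain ⟨d', hd'I, hd'Z⟩ := exists_im_ne_of_finite hZ (by linarith : d + 1 / 2 < d + 1)
  obtain ⟨α', hα'I, hα'Z⟩ := exists_re_ne_of_finite hZ (by linarith : 1 / 2 + η / 4 < 1 / 2 + η / 2)
  have hc'1 : c - 1 ≤ c' := hc'I.1
  have hc'2 : c' ≤ c - 1 / 2 := hc'I.2
  have hd'1 : d + 1 / 2 ≤ d' := hd'I.1
  have hd'2 : d' ≤ d + 1 := hd'I.2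
  have hα'1 : 1 / 2 + η / 4 ≤ α' := hα'I.1
  have hα'2 : α' ≤ 1 / 2 + η / 2 := hα'I.2
  have hc'd' : c' < d' := by linarith
  have hα'3 : α' < 3 := by linarith
  have hc'3 : 3 ≤ c' := by linarith
  -- membership helper: points of `[α', 3] × [c', d']` lie in the big rectangle
  have hmemBig : ∀ {x y : ℝ}, x ∈ Icc α' 3 → y ∈ Icc c' d' →
      ((x : ℂ) + y * I) ∈ (Icc (1 / 4 : ℝ) 4 ×ℂ Icc (c - 1) (d + 1)) := by
    intro x y hx hy
    refine ⟨?_, ?_⟩ <;> simp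
    · constructor <;> linarith [hx.1, hx.2]
    · constructor <;> linarith [hy.1, hy.2]
  have hanal' : AnalyticOnNhd ℂ F (Icc α' 3 ×ℂ Icc c' d') := analyticOnNhd_zeta_mul_psi X (by linarith)
  have h_bot : ∀ x ∈ Icc α' 3, F (x + c' * I) ≠ 0 := by
    intro x hx h0
    exact hc'Z _ ⟨h0, hmemBig hx ⟨le_rfl, hc'd'.le⟩⟩ (by simp)
  have h_top : ∀ x ∈ Icc α' 3, F (x + d' * I) ≠ 0 := by
    intro x hx h0
    exact hd'Z _ ⟨h0, hmemBig hx ⟨hc'd'.le, le_rfl⟩⟩ (by simp)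
  have h_left : ∀ y ∈ Icc c' d', F (α' + y * I) ≠ 0 := by
    intro y hy h0
    exact hα'Z _ ⟨h0, hmemBig ⟨le_rfl, hα'3.le⟩ hy⟩ (by simp)
  have h_right : ∀ y ∈ Icc c' d', F ((3 : ℝ) + y * I) ≠ 0 := fun y _ =>
    (rightEdge_facts hX16 (s := ((3 : ℝ) : ℂ) + y * I) (by simp)).2.2.2.2
  -- Backlund on the horizontal edges
  set A := π * (15 * (Real.log 10 + 4 * Real.log (d' + 12) + Real.log X) + 1) with hA
  have hA_top : ∀ x ∈ Icc α' 3, |(∫ u : ℝ in (3 : ℝ)..x, deriv F (u + d' * I) / F (u + d' * I)).im| ≤ A := by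
    intro x hx
    exact abs_im_integral_logDeriv_horizontal_le hX16 (by linarith) (by linarith [hx.1]) hx.2
      (fun u hu => h_top u ⟨hx.1.trans hu.1, hu.2⟩)
  have hA_bot : ∀ x ∈ Icc α' 3, |(∫ u : ℝ in (3 : ℝ)..x, deriv F (u + c' * I) / F (u + c' * I)).im| ≤ A := by
    intro x hx
    refine (abs_im_integral_logDeriv_horizontal_le hX16 (by linarith) (by linarith [hx.1]) hx.2
      (fun u hu => h_bot u ⟨hx.1.trans hu.1, hu.2⟩)).trans ?_
    rw [hA]
    have : Real.log (c' + 12) ≤ Real.log (d' + 12) := Real.log_le_log (by linarith) (by linarith)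
    nlinarith [Real.pi_pos]
  -- the right edge: `Re F > 0`
  have hB : |(∫ y : ℝ in c'..d', deriv F ((3 : ℝ) + y * I) / F ((3 : ℝ) + y * I)).re| ≤ π := by
    refine (abs_re_integral_logDeriv_vertical_lt_pi (f := F) (3 : ℝ) hc'd'.le (fun y _ => ?_) (fun y _ => ?_)).le
    · exact analyticAt_zeta_mul_psi X (by intro h; have := congrArg Complex.re h; simp at this)
    · exact (rightEdge_facts hX16 (s := ((3 : ℝ) : ℂ) + y * I) (by simp)).2.2.1
  -- Littlewood's lemma
  have LW := littlewood_lemma_le hα'3 hc'd' hanal' h_bot h_top h_left h_right hA_top hA_bot hB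
  -- from the weighted sum to the count
  have hw' : (((3 : ℝ) : ℂ) + c' * I) ∈ (Icc α' 3 ×ℂ Icc c' d') := by
    refine ⟨⟨?_, ?_⟩, ⟨?_, ?_⟩⟩ <;> norm_num <;> linarith
  have hFw' : F (((3 : ℝ) : ℂ) + c' * I) ≠ 0 := h_right c' ⟨le_rfl, hc'd'.le⟩
  have SO := sum_order_le_of_lt hα'3.le hc'd'.le hanal' hw' hFw' (σ := 1 / 2 + η) (by linarith)
  have NC := sum_zetaZeroOrder_le_finsum (X := X) (a := α') (c' := c') (d' := d') (c := c) (d := d)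
    (σ := 1 / 2 + η) hα'3.le (by linarith) hc'd'.le (by linarith) (by linarith) (by linarith) hw' hFw' Z₀ hZ₀
  -- the left edge
  set θ' := (α' - 1 / 2) / (3 - 1 / 2) with hθ'
  have hθ'1 : η / 10 ≤ θ' := by rw [hθ', le_div_iff₀ (by norm_num)]; linarith
  have hθ'2 : θ' ≤ 1 := by rw [hθ', div_le_one (by norm_num)]; linarith
  have hθ'0 : 0 ≤ θ' := by linarith
  set Q := B₁ * (25 / X) ^ (η / 10) with hQ
  have hQ0 : 0 < Q := by rw [hQ]; positivity
  have hJ3 := meanSquare_zetaMollifierG_three_le (T₀ := T₀) (by linarith : (4 : ℝ) ≤ X) hV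
  have hconv := meanSquare_zetaMollifierG_le_interp (X := X) (T₀ := T₀) hX1 hV (σ := α') ⟨by linarith, hα'3.le⟩
  have hJα : ∫ y : ℝ, ‖zetaMollifierG X T₀ V (α' + y * I)‖ ^ 2 ≤ Q := by
    refine hconv.trans ?_
    have hI0 : 0 ≤ ∫ y : ℝ, ‖zetaMollifierG X T₀ V ((1 / 2 : ℝ) + y * I)‖ ^ 2 :=
      integral_nonneg fun y => by positivity
    have hI3 : 0 ≤ ∫ y : ℝ, ‖zetaMollifierG X T₀ V ((3 : ℝ) + y * I)‖ ^ 2 :=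
      integral_nonneg fun y => by positivity
    have step1 : (∫ y : ℝ, ‖zetaMollifierG X T₀ V ((1 / 2 : ℝ) + y * I)‖ ^ 2) ^ (1 - θ') *
        (∫ y : ℝ, ‖zetaMollifierG X T₀ V ((3 : ℝ) + y * I)‖ ^ 2) ^ θ' ≤
        B₁ ^ (1 - θ') * (25 * V / X) ^ θ' := by
      refine mul_le_mul (Real.rpow_le_rpow hI0 hJ (by linarith)) (Real.rpow_le_rpow hI3 hJ3 hθ'0)
        (by positivity) (by positivity)
    refine step1.trans ?_
    -- `B₁^{1−θ'} (25V/X)^{θ'} = B₁ u^{θ'}`, `u = 25V/(XB₁) ≤ 25/X ≤ 1`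
    set u := 25 * V / (X * B₁) with hu
    have hu0 : 0 < u := by rw [hu]; positivity
    have hu1 : u ≤ 25 / X := by
      rw [hu, div_le_div_iff₀ (by positivity) hX0]
      have : V * X ≤ B₁ * X := mul_le_mul_of_nonneg_right hB₁ hX0.le
      nlinarith
    have hu1' : u ≤ 1 := hu1.trans (by rw [div_le_one hX0]; linarith)
    have e1 : 25 * V / X = B₁ * u := by rw [hu]; field_simp
    rw [e1, Real.mul_rpow hB₁0.le hu0.le, ← mul_assoc, ← Real.rpow_add hB₁0, show 1 - θ' + θ' = 1 by ring,
      Real.rpow_one, hQ]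
    refine mul_le_mul_of_nonneg_left ?_ hB₁0.le
    calc u ^ θ' ≤ u ^ (η / 10) := Real.rpow_le_rpow_of_exponent_ge hu0 hu1' hθ'1
      _ ≤ (25 / X) ^ (η / 10) := Real.rpow_le_rpow hu0.le hu1 (by positivity)
  -- choice of `λ`
  set r := Real.sqrt (22 * Q * (d' - c')) with hr
  have hdc' : 0 < d' - c' := by linarith
  have hr0 : 0 < r := by rw [hr]; positivity
  have hrsq : r ^ 2 = 22 * Q * (d' - c') := by rw [hr, Real.sq_sqrt (by positivity)]
  set lam := r / (d' - c') with hlam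
  have hlam0 : 0 < lam := by rw [hlam]; positivity
  have hleft := integral_log_norm_leftEdge_le (X := X) (T₀ := T₀) (V := V) (α := α') (c := c') (d := d')
    hX1 hV (by linarith) hα'3.le hc'3 hc'd'.le (by linarith) (by linarith) hlam0 h_left
  have hleft' : ∫ y in c'..d', Real.log ‖riemannZeta (α' + y * I) * plateauMollifier X (α' + y * I)‖ ≤ r := by
    refine hleft.trans ?_
    have h1 : (d' - c') * lam / 2 = r / 2 := by rw [hlam]; field_simp
    have h2 : 11 / lam * ∫ y : ℝ, ‖zetaMollifierG X T₀ V (α' + y * I)‖ ^ 2 ≤ r / 2 := by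
      calc 11 / lam * ∫ y : ℝ, ‖zetaMollifierG X T₀ V (α' + y * I)‖ ^ 2 ≤ 11 / lam * Q :=
            mul_le_mul_of_nonneg_left hJα (by positivity)
        _ = r / 2 := by
            rw [hlam]; field_simp; nlinarith [hrsq]
    linarith
  have hright := neg_integral_log_norm_rightEdge_le hX16 hc'd'.le
  -- assemble
  have hr_le : r ≤ Real.sqrt (22 * Q * (d - c + 2)) := by
    rw [hr]; exact Real.sqrt_le_sqrt (by nlinarith [hQ0.le])
  have hA_le : A ≤ π * (15 * (Real.log 10 + 4 * Real.log (d + 13) + Real.log X) + 1) := by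
    rw [hA]
    have : Real.log (d' + 12) ≤ Real.log (d + 13) := Real.log_le_log (by linarith) (by linarith)
    nlinarith [Real.pi_pos]
  set FINAL := Real.sqrt (22 * Q * (d - c + 2)) + 4 * (d - c + 2) * X ^ (-(1 / 2 : ℝ))
      + 5 * (π * (15 * (Real.log 10 + 4 * Real.log (d + 13) + Real.log X) + 1)) + 5 / 2 * π with hFINAL
  have hlog10 : 0 ≤ Real.log 10 := Real.log_nonneg (by norm_num)
  have hlogd : 0 ≤ Real.log (d + 13) := Real.log_nonneg (by linarith)
  have hlogX : 0 ≤ Real.log X := Real.log_nonneg hX1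
  have hFINAL0 : 0 ≤ FINAL := by rw [hFINAL]; positivity
  -- the RHS of Littlewood ≤ FINAL
  have hRHS : (∫ y : ℝ in c'..d', Real.log ‖F (α' + y * I)‖) - (∫ y : ℝ in c'..d', Real.log ‖F ((3 : ℝ) + y * I)‖) +
      (3 - α') * (2 * A + π) ≤ FINAL := by
    have h1 : (∫ y : ℝ in c'..d', Real.log ‖F (α' + y * I)‖) ≤ r := by simpa [hF] using hleft'
    have h2 : -(∫ y : ℝ in c'..d', Real.log ‖F ((3 : ℝ) + y * I)‖) ≤ 4 * (d' - c') * X ^ (-(1 / 2 : ℝ)) := by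
      simpa [hF] using hright
    have h3 : (3 - α') * (2 * A + π) ≤ 5 * A + 5 / 2 * π := by
      have hA0 : 0 ≤ A := by rw [hA]; have : 0 ≤ Real.log (d' + 12) := Real.log_nonneg (by linarith); positivity
      nlinarith [Real.pi_pos]
    have h4 : 4 * (d' - c') * X ^ (-(1 / 2 : ℝ)) ≤ 4 * (d - c + 2) * X ^ (-(1 / 2 : ℝ)) := by
      have : 0 ≤ X ^ (-(1 / 2 : ℝ)) := by positivity
      nlinarith
    rw [hFINAL]; linarith
  -- combine the three inequalities
  have hσα : η / 2 ≤ 1 / 2 + η - α' := by linarith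
  have hsum_le : 2 * Real.pi * ((1 / 2 + η - α') *
      ∑ᶠ ρ ∈ {ρ : ℂ | F ρ = 0 ∧ ρ ∈ Ico (1 / 2 + η) 3 ×ℂ Ioo c' d'}, ((meromorphicOrderAt F ρ).untop₀ : ℝ)) ≤ FINAL := by
    have := mul_le_mul_of_nonneg_left SO (by positivity : (0 : ℝ) ≤ 2 * Real.pi)
    exact this.trans (LW.trans hRHS)
  have hN : (∑ ρ ∈ Z₀, (riemannZetaZeroOrder ρ : ℝ)) *
      (2 * Real.pi * (1 / 2 + η - α')) ≤ FINAL := by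
    have hS0 : 0 ≤ 2 * Real.pi * (1 / 2 + η - α') := by
      have : 0 ≤ 1 / 2 + η - α' := by linarith
      positivity
    calc _ ≤ (∑ᶠ ρ ∈ {ρ : ℂ | F ρ = 0 ∧ ρ ∈ Ico (1 / 2 + η) 3 ×ℂ Ioo c' d'}, ((meromorphicOrderAt F ρ).untop₀ : ℝ)) *
          (2 * Real.pi * (1 / 2 + η - α')) := mul_le_mul_of_nonneg_right (by simpa [hF] using NC) hS0
      _ = _ := by ring
      _ ≤ FINAL := hsum_le
  have hden : Real.pi * η ≤ 2 * Real.pi * (1 / 2 + η - α') := by nlinarith [Real.pi_pos]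
  have hden0 : 0 < Real.pi * η := by positivity
  rw [show (1 / (π * η)) * (Real.sqrt (22 * (B₁ * (25 / X) ^ (η / 10)) * (d - c + 2))
        + 4 * (d - c + 2) * X ^ (-(1 / 2 : ℝ))
        + 5 * (π * (15 * (Real.log 10 + 4 * Real.log (d + 13) + Real.log X) + 1)) + 5 / 2 * π) = FINAL / (π * η) by
    rw [hFINAL, hQ]; ring]
  rw [le_div_iff₀ hden0]
  have hZnn : 0 ≤ ∑ ρ ∈ Z₀, (riemannZetaZeroOrder ρ : ℝ) :=
    Finset.sum_nonneg fun ρ hρ => riemannZetaZeroOrder_nonneg_of_zero (hZ₀ ρ hρ).1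
  calc _ ≤ (∑ ρ ∈ Z₀, (riemannZetaZeroOrder ρ : ℝ)) *
        (2 * Real.pi * (1 / 2 + η - α')) := mul_le_mul_of_nonneg_left hden hZnn
    _ ≤ FINAL := hN

end Literature.NumberTheory.LFunctions.TwistedMoment
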